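import Summits.AtomisticToContinuum.HydrodynamicLimit.Theorems.JParityClosureEvenStressEnskogClusterTransportIntegral
import Summits.AtomisticToContinuum.HydrodynamicLimit.Theorems.JParityClosureEmpiricalEnskogIdentity
import HarnessLib

/-!
# The Eulerian-window CLUSTER TRANSPORT IDENTITY along one good hard-sphere orbit
# (`stub_clusterTransport`, stub S1 "FREEZE, pathwise" of the line
# `stationary-microscale-hierarchy-entrance-law` of the crux `JParityClosure.EvenStressEnskog`,
# stmt-AtomisticToContinuum-13079)

For `N + 1` hard spheres of diameter `ε = hsDiameter σ N` on `𝕋³`, a good datum `z` of a hard-sphere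
flow `Φ`, a weight `W = χ(s, x₀) g(σ³ρ_r(Φ_s z, x₀))` (`χ` continuous with a continuous
`s`-derivative, `g ∈ C¹`, `0 < r < 1/2`) and a compactly supported `C¹` tuple test function `P` of
level `m` whose closed position support fits in the injectivity radius (`ε‖ξ_a‖ < 1/2` on
`tsupport P`), the weighted window integral `I(s) = winInt … s z = ∫ W winObs(Φ_s z, x₀) dx₀`
satisfies the exact pathwise bookkeeping identity
`ε (I(τ) − I(0)) − ε ∫₀^τ∫ Ẇ winObs − ∫₀^τ∫ W streamObs = ε Σ_{collisions s ∈ (0, τ]} ∫ W (winObs − winObs∘pre)`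
(`wRateStat`, `streamStat`, `collJump` of `Literature…MicroscaleWindowFunctionals`): the level-`m`,
fixed-centre sibling of the proved route item `EmpiricalEnskogIdentity` (stmt-13086).

Proof (`clusterTransport_identity`): the weak balance law for time-dependent observables
`IsHardSphereTrajectory.sub_eq_integral_add_finsum_collisionJump_td` applied to
`F(s, w) = ε ∫ W(s, x₀, w) winObs(w, x₀) dx₀`, whose free-streaming derivative is `ε A + B`,
`A = ∫ Ẇ winObs`, `B = ∫ W streamObs` (parts I–IV: differentiation under the integral sign, the
integrand being Lipschitz in time uniformly in the centre and differentiable at Haar-a.e. centre;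
continuity of `A`, `B` along free flights by dominated convergence), together with

* the interval integrability of `A`, `B` along the orbit (`intervalIntegrable_of_continuous_flight`),
  so that `∫ (ε A + B) = ε ∫ A + ∫ B`;
* the jump at a collision time (`collisionJump_winInt_eq`): positions — hence `W` — do not jump,
  and the pre-collisional configuration read off the right-continuous orbit by `preConfig`
  IS the left limit (`preConfig_eq_leftLim`: exactly the ordered pairs `(i, j)`, `(j, i)` are in
  contact, `collisionPair_eq_or_eq_of_mem_contactSet`, and the reflection of the outgoing pair is
  the incoming pair, `reflectVel_collidePair_vel`).

The identity holds for `0 ≤ τ` and needs neither `ε < 1/2` nor `σ < 1/2`.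

References: H. Spohn, *Large Scale Dynamics of Interacting Particles* (1991), Part I §3.2
(weak balance laws along the flow). [folklore]
-/

noncomputable section

open MeasureTheory Set Filter Function Metric
open scoped BigOperators Topology InnerProductSpace

namespace Summit.AtomisticToContinuum.HydrodynamicLimit.Theorems.EvenStressEnskog

open Literature.Analysis.FluidPDE Literature.Analysis.FunctionSpaces
  Literature.MathematicalPhysics.KineticTheory
  Literature.MathematicalPhysics.KineticTheory.StationaryMicroscale

/-! ## The pre-collisional configuration is the left limit -/

/-- **On a hard-sphere trajectory on `𝕋³`, at a collision time the configuration `preConfig ε (γ t)`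
(velocities replaced by their `reflectVel` on the unique contact partner) is the left limit
`γ(t⁻)`**: positions do not jump; the colliding pair `{i, j}` is the only pair in contact
(`collisionPair_eq_or_eq_of_mem_contactSet`) and reflecting its outgoing velocities gives the
incoming ones (`reflectVel_collidePair_vel`); the other particles are in contact with nobody and do
not jump. [folklore] -/
theorem preConfig_eq_leftLim :
    ∀ {N : ℕ} {ε : ℝ} {γ : ℝ → Config (N + 1) (Fin 3) T3},
      IsHardSphereTrajectory (Torus.geometry (Fin 3)) ε (N + 1) γ →
      ∀ {t : ℝ}, t ∈ collisionTimes (Torus.geometry (Fin 3)) ε γ → preConfig ε (γ t) = leftLim γ t := by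
  intro N ε γ h t ht
  have hG := continuous_translate_torus3
  obtain ⟨i, j, hij, hc⟩ := mem_collisionTimes.1 ht
  have hcji : γ t ∈ contactSet (Torus.geometry (Fin 3)) (N + 1) ε j i := mem_contactSet_symm_torus hc
  have hpos : ∀ k, (leftLim γ t k).1 = (γ t k).1 := h.leftLim_apply_fst hG t
  have hother : ∀ k, k ≠ i → k ≠ j → γ t k = leftLim γ t k := fun k hki hkj =>
    h.apply_eq_leftLim_apply_of_ne hij hc hki hkj
  have hγij : γ t = collidePair (Torus.geometry (Fin 3)) i j (leftLim γ t) :=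
    (h.eq_collidePair_leftLim hij hc).2
  have hγji : γ t = collidePair (Torus.geometry (Fin 3)) j i (leftLim γ t) :=
    (h.eq_collidePair_leftLim hij.symm hcji).2
  have hvi : (reflectVel ((Torus.geometry (Fin 3)).sepVec (γ t i).1 (γ t j).1)
      ((γ t i).2, (γ t j).2)).1 = (leftLim γ t i).2 := by
    have e := reflectVel_collidePair_vel (G := Torus.geometry (Fin 3)) hij (leftLim γ t)
    rw [← hγij] at e
    rw [e]
  have hvj : (reflectVel ((Torus.geometry (Fin 3)).sepVec (γ t j).1 (γ t i).1)
      ((γ t j).2, (γ t i).2)).1 = (leftLim γ t j).2 := by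
    have e := reflectVel_collidePair_vel (G := Torus.geometry (Fin 3)) hij.symm (leftLim γ t)
    rw [← hγji] at e
    rw [e]
  -- the contact partner is unique
  have hpair : ∀ k l : Fin (N + 1), l ≠ k →
      ‖(Torus.geometry (Fin 3)).sepVec (γ t k).1 (γ t l).1‖ = ε → k = i ∧ l = j ∨ k = j ∧ l = i := by
    intro k l hlk hnorm
    have hc' : γ t ∈ contactSet (Torus.geometry (Fin 3)) (N + 1) ε k l :=
      mem_contactSet.2 ⟨h.mem t, hnorm⟩
    exact collisionPair_eq_or_eq_of_mem_contactSet h hij hc (Ne.symm hlk) hc'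
  funext k
  refine Prod.ext ?_ ?_
  · rw [preConfig_apply_fst, hpos]
  rw [preConfig_apply_snd]
  rcases eq_or_ne k i with rfl | hki
  · unfold preVelocity
    rw [Finset.sum_eq_single j, if_pos ⟨hij.symm, (mem_contactSet.1 hc).2⟩, hvi, add_sub_cancel]
    · intro l _ hlj
      rw [if_neg]
      rintro ⟨hlk, hnorm⟩
      rcases hpair k l hlk hnorm with ⟨_, hl⟩ | ⟨hkj, _⟩
      · exact hlj hl
      · exact hij hkj
    · exact fun hj => absurd (Finset.mem_univ j) hj
  rcases eq_or_ne k j with rfl | hkj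
  · unfold preVelocity
    rw [Finset.sum_eq_single i, if_pos ⟨hij, (mem_contactSet.1 hcji).2⟩, hvj, add_sub_cancel]
    · intro l _ hli
      rw [if_neg]
      rintro ⟨hlk, hnorm⟩
      rcases hpair k l hlk hnorm with ⟨hki', _⟩ | ⟨_, hl⟩
      · exact hki hki'
      · exact hli hl
    · exact fun hi => absurd (Finset.mem_univ i) hi
  · rw [preVelocity_eq_of_forall_ne, hother k hki hkj]
    intro l hlk hnorm
    rcases hpair k l hlk hnorm with ⟨hk, _⟩ | ⟨hk, _⟩
    · exact hki hk
    · exact hkj hk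

/-- The weight only reads positions: `W(s, x₀, preConfig ε z) = W(s, x₀, z)`. [folklore] -/
theorem weight_preConfig {N : ℕ} (σ : ℝ) (χ : ℝ × T3 → ℝ) (g : ℝ → ℝ) (r s ε : ℝ)
    (z : Config (N + 1) (Fin 3) T3) (x₀ : T3) :
    weight σ χ g r s (preConfig ε z) x₀ = weight σ χ g r s z x₀ := by
  unfold weight
  rw [mollDensity_eq_avg, mollDensity_eq_avg]
  simp only [preConfig_apply_fst]

/-! ## The jump of the weighted window integral at a collision -/

section Jump

variable {N m : ℕ} {σ ε ρ r : ℝ} {χ : ℝ × T3 → ℝ} {g : ℝ → ℝ} {P : (Fin m → V3 × V3) → ℝ}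

/-- **The frozen-time jump of `F(s, w) = ε ∫ W winObs dx₀` at a collision time** of a hard-sphere
trajectory on `𝕋³` is `ε ∫ W (winObs(γ s) − winObs(preConfig ε (γ s))) dx₀` (the summand of
`collJump`; `preConfig_eq_leftLim`, `weight_preConfig`). [folklore] -/
theorem collisionJump_winInt_eq (hε : 0 < ε) (hρ : ρ < 1 / 2) (hχ : Continuous χ)
    (hg : Continuous g) (hP : ContDiff ℝ 1 P) (hmargin : ∀ q ∈ tsupport P, ∀ a, ε * ‖(q a).1‖ ≤ ρ)
    {γ : ℝ → Config (N + 1) (Fin 3) T3}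
    (hγ : IsHardSphereTrajectory (Torus.geometry (Fin 3)) ε (N + 1) γ) {s : ℝ}
    (hs : s ∈ collisionTimes (Torus.geometry (Fin 3)) ε γ) :
    collisionJump (fun w : Config (N + 1) (Fin 3) T3 =>
        ε * ∫ x₀ : T3, weight σ χ g r s w x₀ * winObs ε P w x₀) γ s =
      ε * ∫ x₀ : T3, weight σ χ g r s (γ s) x₀ *
        (winObs ε P (γ s) x₀ - winObs ε P (preConfig ε (γ s)) x₀) := by
  rw [collisionJump, ← preConfig_eq_leftLim hγ hs, ← mul_sub,
    ← integral_sub (integrable_weight_mul_winObs σ hε hρ hχ hg hP hmargin r s (γ s))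
      (integrable_weight_mul_winObs σ hε hρ hχ hg hP hmargin r s (preConfig ε (γ s)))]
  congr 1
  refine integral_congr_ae (ae_of_all _ fun x₀ => ?_)
  beta_reduce
  rw [weight_preConfig, mul_sub]

end Jump

/-! ## The identity -/

/-- **The Eulerian-window cluster transport identity** (explicit form, `0 ≤ τ`): along the orbit of a
good datum, `ε (I(τ) − I(0)) − ε · wRateStat − streamStat = collJump`. Proof: the time-dependent
weak balance law `sub_eq_integral_add_finsum_collisionJump_td` for `F(s, w) = ε ∫ W winObs dx₀` with
free-streaming derivative `ε A + B` (`hasDerivAt_integral_weight_winObs_flight'`,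
`integral_rate_split`, continuity `continuous_integral_…_flight'`), the interval integrability of
`A`, `B` along the orbit (`intervalIntegrable_of_continuous_flight`), and the jump
`collisionJump_winInt_eq` at each collision time. [folklore] -/
theorem clusterTransport_identity {σ : ℝ} {N : ℕ} (hσ : 0 < σ)
    (Φ : HardSphereFlow (Torus.geometry (Fin 3)) (hsDiameter σ N) (N + 1))
    {z : Config (N + 1) (Fin 3) T3} (hz : z ∈ Φ.good) {τ : ℝ} (hτ : 0 ≤ τ) {χ : ℝ × T3 → ℝ}
    (hχ : Continuous χ) (hχd : ∀ x₀, Differentiable ℝ fun s => χ (s, x₀))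
    (hχ' : Continuous fun p : ℝ × T3 => deriv (fun s => χ (s, p.2)) p.1) {g : ℝ → ℝ}
    (hg : ContDiff ℝ 1 g) {r : ℝ} (hr : 0 < r) (hr2 : r < 1 / 2) {m : ℕ}
    {P : (Fin m → V3 × V3) → ℝ} (hP : ContDiff ℝ 1 P) (hPc : HasCompactSupport P)
    (hsupp : ∀ q ∈ tsupport P, ∀ a, hsDiameter σ N * ‖(q a).1‖ < 1 / 2) :
    hsDiameter σ N * (winInt σ N Φ χ g r P τ z - winInt σ N Φ χ g r P 0 z)
        - hsDiameter σ N * wRateStat σ N Φ τ χ g r P z - streamStat σ N Φ τ χ g r P z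
        = collJump σ N Φ τ χ g r P z := by
  have hε : 0 < hsDiameter σ N := hsDiameter_pos hσ N
  obtain ⟨ρ, hρ, hmargin⟩ := exists_tsupport_margin (hsDiameter σ N) hPc hsupp
  have htraj : IsHardSphereTrajectory (Torus.geometry (Fin 3)) (hsDiameter σ N) (N + 1)
      (fun s => Φ.flow s z) := Φ.isTrajectory z hz
  -- the observable, its two rate functionals and its free-streaming derivative
  set F : ℝ → Config (N + 1) (Fin 3) T3 → ℝ := fun s w =>
    hsDiameter σ N * ∫ x₀ : T3, weight σ χ g r s w x₀ * winObs (hsDiameter σ N) P w x₀ with hFdef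
  set A : ℝ → Config (N + 1) (Fin 3) T3 → ℝ := fun s w =>
    ∫ x₀ : T3, weightRate σ χ g r s w x₀ * winObs (hsDiameter σ N) P w x₀ with hAdef
  set B : ℝ → Config (N + 1) (Fin 3) T3 → ℝ := fun s w =>
    ∫ x₀ : T3, weight σ χ g r s w x₀ * streamObs (hsDiameter σ N) P w x₀ with hBdef
  set F' : ℝ → Config (N + 1) (Fin 3) T3 → ℝ := fun s w => hsDiameter σ N * A s w + B s w
    with hF'def
  have hF : ∀ (w : Config (N + 1) (Fin 3) T3) (t₀ t : ℝ),
      HasDerivAt (fun s => F s (freeFlight (Torus.geometry (Fin 3)) (s - t₀) w))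
        (F' t (freeFlight (Torus.geometry (Fin 3)) (t - t₀) w)) t := by
    intro w t₀ t
    have h := (hasDerivAt_integral_weight_winObs_flight' hσ hε hρ hr hr2 hχ hχd hχ' hg hP hPc
      hmargin w t₀ t).const_mul (hsDiameter σ N)
    refine h.congr_deriv ?_
    rw [integral_rate_split hσ.le hε hρ hr hχ hχ' hg hP hPc hmargin, mul_add, ← mul_assoc,
      mul_inv_cancel₀ hε.ne', one_mul]
  have hF' : ∀ (w : Config (N + 1) (Fin 3) T3) (t₀ : ℝ),
      Continuous fun t => F' t (freeFlight (Torus.geometry (Fin 3)) (t - t₀) w) := fun w t₀ =>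
    (continuous_const.mul (continuous_integral_weightRate_winObs_flight' hσ hε hρ hr hr2 hχ hχ' hg
      hP hPc hmargin w t₀)).add
      (continuous_integral_weight_streamObs_flight' hσ hε hρ hr hχ hχ' hg hP hPc hmargin w t₀)
  -- the weak balance law along the orbit
  have key := (htraj.sub_eq_integral_add_finsum_collisionJump_td (F := F) (F' := F')
    continuous_translate_torus3 hF hF' hτ).2
  -- both rate functionals are integrable along the orbit, so the rate integral splits
  have hA : IntervalIntegrable (fun s => A s (Φ.flow s z)) volume 0 τ :=
    intervalIntegrable_of_continuous_flight htraj (Q := A)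
      (fun w t₀ => continuous_integral_weightRate_winObs_flight' hσ hε hρ hr hr2 hχ hχ' hg hP hPc
        hmargin w t₀) hτ
  have hB : IntervalIntegrable (fun s => B s (Φ.flow s z)) volume 0 τ :=
    intervalIntegrable_of_continuous_flight htraj (Q := B)
      (fun w t₀ => continuous_integral_weight_streamObs_flight' hσ hε hρ hr hχ hχ' hg hP hPc
        hmargin w t₀) hτ
  have hint : ∫ s in (0 : ℝ)..τ, F' s (Φ.flow s z) =
      hsDiameter σ N * (∫ s in (0 : ℝ)..τ, A s (Φ.flow s z)) + ∫ s in (0 : ℝ)..τ, B s (Φ.flow s z) := by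
    rw [← intervalIntegral.integral_const_mul, ← intervalIntegral.integral_add (hA.const_mul _) hB]
  -- unfold the four functionals of the statement
  have hwin : ∀ s, hsDiameter σ N * winInt σ N Φ χ g r P s z = F s (Φ.flow s z) := fun s => rfl
  have hrate : wRateStat σ N Φ τ χ g r P z = ∫ s in (0 : ℝ)..τ, A s (Φ.flow s z) := by
    unfold wRateStat
    rw [intervalIntegral.integral_of_le hτ, integral_Icc_eq_integral_Ioc]
  have hstream : streamStat σ N Φ τ χ g r P z = ∫ s in (0 : ℝ)..τ, B s (Φ.flow s z) := by
    unfold streamStat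
    rw [intervalIntegral.integral_of_le hτ, integral_Icc_eq_integral_Ioc]
  have hjumps : (∑ᶠ s ∈ collisionTimes (Torus.geometry (Fin 3)) (hsDiameter σ N) (fun s => Φ.flow s z) ∩
      Ioc 0 τ, collisionJump (F s) (fun s => Φ.flow s z) s) = collJump σ N Φ τ χ g r P z := by
    unfold collJump
    rw [mul_finsum_mem]
    refine finsum_mem_congr rfl fun s hs => ?_
    exact collisionJump_winInt_eq hε hρ hχ hg.continuous hP hmargin htraj hs.1
  rw [mul_sub, hwin, hwin, hrate, hstream, ← hjumps, key, hint]
  ring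

/-- **S1 · CLUSTER TRANSPORT (FREEZE, pathwise)** — the registered stub of the line
`stationary-microscale-hierarchy-entrance-law` (`Stubs.stub_clusterTransport = ClusterTransportIdentity`
of the crux skeleton), verbatim: the Eulerian-window cluster transport identity along one good orbit
(`clusterTransport_identity`; the hypothesis `0 < τ` is only used as `0 ≤ τ`). [folklore] -/
theorem stub_clusterTransport :
  ∀ (σ : ℝ) (N : ℕ), 0 < σ → ∀ Φ : HardSphereFlow (Torus.geometry (Fin 3)) (hsDiameter σ N) (N + 1), ∀ z ∈ Φ.good,
    ∀ τ : ℝ, 0 < τ → ∀ χ : ℝ × T3 → ℝ, Continuous χ → (∀ x₀, Differentiable ℝ fun s => χ (s, x₀)) →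
    Continuous (fun p : ℝ × T3 => deriv (fun s => χ (s, p.2)) p.1) →
    ∀ g : ℝ → ℝ, ContDiff ℝ 1 g → ∀ r : ℝ, 0 < r → r < 1 / 2 →
    ∀ (m : ℕ) (P : (Fin m → V3 × V3) → ℝ), ContDiff ℝ 1 P → HasCompactSupport P →
    (∀ q ∈ tsupport P, ∀ a, hsDiameter σ N * ‖(q a).1‖ < 1 / 2) →
      hsDiameter σ N * (winInt σ N Φ χ g r P τ z - winInt σ N Φ χ g r P 0 z)
        - hsDiameter σ N * wRateStat σ N Φ τ χ g r P z - streamStat σ N Φ τ χ g r P z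
        = collJump σ N Φ τ χ g r P z :=
  fun _σ _N hσ Φ _z hz _τ hτ _χ hχ hχd hχ' _g hg _r hr hr2 _m _P hP hPc hsupp =>
    clusterTransport_identity hσ Φ hz hτ.le hχ hχd hχ' hg hr hr2 hP hPc hsupp

end Summit.AtomisticToContinuum.HydrodynamicLimit.Theorems.EvenStressEnskog

end
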